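import Summits.ResolutionOfSingularities.ResolutionOfSingularities.Theorems.PurelyInseparableDim4ResConeSatLocated
import Summits.ResolutionOfSingularities.ResolutionOfSingularities.Theorems.PurelyInseparableDim4ResConePolarFree
import HarnessLib
import HarnessLib.Audit.Tags

/-!
# Purely inseparable four-folds — the TAME CONE AT A CONSTANT-`d` STEP, XII: FORM PERSISTENCE — on a
# constant-`(d, e_G)` band step with `d < p` the new residual cone IS the old one, up to a unit and a
# unipotent linear substitution (idea-4 CARD I-4-6 (B-PERSIST) / I-4-8 §A «in_d G′ = B(y′)», every prime,
# every `1 ≤ e_G`; K2(p) lane, SLICE C file-holder res-dim4-p-5 g3)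

[OURS · counted 0 · cell `res-dim4-pi` · K2(p) lane (desk WORDS #66 (2), #75, #78 (d)) · seat res-dim4-p-5 g3.]
Nothing here proves K2(p), `NoIsolatedTrap p p` or resolution of singularities in dimension ≥ 4 /
characteristic `p`.

Setting (`…ResCone*`): a shade-keeping band step `s →(j, b) s′` (`x^r ∣ F`, `q < ord₀ F = o < 2q`, `b_j = 0`),
residual cones `g = resForm s`, `g′ = resForm s′`, polar kernels `V = resVertex s`, `V′ = resVertex s′`.  The tree
knows the `x_j`-FREE LAYER of `g′` (`…ResConeLayer.killVar_resForm_step`: `g′|_{x_j = 0} = c · shear j b g`,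
`c ≠ 0`) and that on a constant-`e_G` step `V′ ⊄ H_j` (`…ResConeSatLocated`).  This file adds the TAME
translation-invariance that turns the layer statement into an identity of forms:

* §1 `killVar_shear` — `(shear j t P)|_{x_j = 0} = P|_{x_j = 0}`;
* §2 **`shear_free_of_direction_mem_additiveSubspace`** — the converse of `…ResCone`'s
  `direction_mem_additiveSubspace_of_shear_free` for TAME forms (`deg Φ = d < p`): if `e_j + t ∈ A(Φ)` then
  `shear j t Φ` is `x_j`-free (`∂_j (shear j t Φ) = shear j t (D_{e_j + t} Φ) = 0` and `…PolarFree`); hence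
  **`eq_shear_killVar_of_direction_mem_additiveSubspace`**: `Φ = shear j (−t) (Φ|_{x_j = 0})` — a tame form is
  its restriction to ANY hyperplane `x_j = 0` transverse to a kernel vector, re-sheared (false for `d ≥ p`:
  `Φ = x_j^p`, `A = K⁴`);
* §3 **`resForm_step_eq_smul_shear`** (FORM PERSISTENCE): for every `u ∈ V′` with `u_j = 1`,
  `resForm s′ = c • shear j (b − u♭) (resForm s)` (`u♭ = u` off `j`, `u♭_j = 0`); on a constant-`e_G` step such a
  `u` exists (`exists_transversal_of_finrank_eq`), so **`exists_resForm_step_eq_smul_shear_of_finrank_eq`**: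
  `∃ t, t_j = 0 ∧ e_j + t ∈ V′ ∧ resForm s′ = c • shear j (b − t) (resForm s)`, `c ≠ 0`.  At `e_G = 2` this is
  idea-4's (B-PERSIST): the binary form `B(ℓ₁, ℓ₂)` of the cone keeps its `GL₂`-class — in particular its ROOT
  MULTIPLICITY PATTERN — along the whole constant-`(d, 2)` tail (the entry ticket of the CJS `e = 2` polygon game);
  at `e_G = 3` it refines `…ResConeFormPersist` (`ℓ′ ∝ ℓ` off the chart) to the level of forms.
* §4 `resForm_step_eq_smul_shear_of_next` — when the NEXT step `s′ →(j′, b′) s″` is also a shade-keeping band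
  step, its direction `e_{j′} + b′ ∈ V′` ((VT)(i)) supplies `u` whenever `(e_{j′} + b′)_j ≠ 0` (a FREE successor):
  `resForm s′ = c • shear j (b − ((b′_j)⁻¹ • (e_{j′} + b′))♭) (resForm s)`; for a REPEAT `j′ = j`
  (`resForm_step_eq_smul_shear_of_repeat`) simply `resForm s′ = c • shear j (b − b′) (resForm s)`.
[cite: CossartJannsenSaito2020, Thm. 3.10(4), Thm. 3.14, Thm. 9.3]
bears_on: LADDER-RESOLUTION:D157-DOOR2 (res-dim4-pi · K2(p) = `RidgeBudget.NoAboveFloorTrap p p` · slices B/C).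
Supports stmt-ResolutionOfSingularities-16155 (helper).
-/

set_option linter.dupNamespace false -- mandated namespace of this single-conjunct summit

noncomputable section

namespace Summit.ResolutionOfSingularities.ResolutionOfSingularities.Theorems.PIDim4

namespace ResCone

open MvPolynomial Finset
open Literature.AlgebraicGeometry.Resolution
open Literature.AlgebraicGeometry.Resolution.CentreBlowup
open Literature.AlgebraicGeometry.Resolution.Hauser2010
open Literature.AlgebraicGeometry.Resolution.HauserPerlega2019
open PointBlowup (polarMap additiveSubspace direction)

variable {K : Type} [Field K]

/-! ## 1. Killing the chart variable after a shear -/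

/-- `(shear j t P)|_{x_j = 0} = P|_{x_j = 0}`: setting `x_j = 0` after `x_i ↦ x_i + t_i x_j` is setting `x_j = 0`.
[folklore] -/
theorem killVar_shear (j : Fin 4) (t : Fin 4 → K) (P : MvPolynomial (Fin 4) K) :
    PointBlowup.killVar j (shear j t P) = PointBlowup.killVar j P := by
  unfold shear PointBlowup.killVar
  rw [← AlgHom.comp_apply, MvPolynomial.comp_aeval]
  have hfun : (fun i => (aeval fun i => if i = j then (0 : MvPolynomial (Fin 4) K) else X i)
      (if i = j then (X j : MvPolynomial (Fin 4) K) else X i + C (t i) * X j)) =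
      fun i => if i = j then (0 : MvPolynomial (Fin 4) K) else X i := by
    funext i
    by_cases hij : i = j
    · subst hij
      simp
    · simp [hij]
  rw [hfun]

/-- `e_j + t` with the `j`-coordinate of `t` irrelevant: `direction j t = direction j (update t j 0)`. [folklore] -/
theorem direction_update_zero (j : Fin 4) (t : Fin 4 → K) :
    direction j (Function.update t j 0) = direction j t := by
  unfold direction
  rw [Function.update_idem]

/-- A vector with `u_j = 1` is the direction of its off-`j` part: `u = direction j (update u j 0)`. [folklore] -/
theorem direction_update_zero_of_apply_eq_one {j : Fin 4} {u : Fin 4 → K} (huj : u j = 1) :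
    direction j (Function.update u j 0) = u := by
  rw [direction_update_zero]
  unfold direction
  rw [← huj, Function.update_eq_self]

/-! ## 2. Tame forms are translation-invariant along their polar kernel -/

/-- **Converse of (VT)(i)'s core, TAME case**: if `Φ` is homogeneous of degree `d < p`, `t_j = 0` and the
direction `e_j + t` lies in the polar kernel `A(Φ)`, then the sheared form `shear j t Φ` does not involve `x_j`.
(`∂_j (shear j t Φ) = shear j t (D_{e_j+t} Φ) = 0`, and a form of degree `< p` with `∂_j = 0` is `x_j`-free.)
[OURS] [cite: CossartJannsenSaito2020, Def. 2.8, Thm. 3.14] -/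
theorem shear_free_of_direction_mem_additiveSubspace (p : ℕ) [Fact p.Prime] [CharP K p]
    {Φ : MvPolynomial (Fin 4) K} {d : ℕ} (hΦ : Φ.IsHomogeneous d) (hdp : d < p) (j : Fin 4)
    {t : Fin 4 → K} (ht : t j = 0) (hmem : direction j t ∈ additiveSubspace Φ) :
    ∀ e ∈ (shear j t Φ).support, e j = 0 := by
  have hpd : pderiv j (shear j t Φ) = 0 := by
    unfold additiveSubspace at hmem
    rw [pderiv_shear_self j ht, LinearMap.mem_ker.mp hmem]
    unfold shear
    exact map_zero _
  exact free_of_pderiv_eq_zero p (isHomogeneous_shear j t hΦ) hdp hpd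

/-- **A TAME FORM IS ITS RESTRICTION TO A TRANSVERSE HYPERPLANE, RE-SHEARED**: for `Φ` homogeneous of degree
`d < p` and `e_j + t ∈ A(Φ)` (`t_j = 0`), `Φ = shear j (−t) (Φ|_{x_j = 0})`, i.e.
`Φ(x) = Φ|_{x_j = 0}(x_i − t_i x_j)`.  (False for `d ≥ p`: `Φ = x_j^p`.) [OURS]
[cite: CossartJannsenSaito2020, Def. 2.8, Thm. 3.14] -/
theorem eq_shear_killVar_of_direction_mem_additiveSubspace (p : ℕ) [Fact p.Prime] [CharP K p]
    {Φ : MvPolynomial (Fin 4) K} {d : ℕ} (hΦ : Φ.IsHomogeneous d) (hdp : d < p) (j : Fin 4)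
    {t : Fin 4 → K} (ht : t j = 0) (hmem : direction j t ∈ additiveSubspace Φ) :
    Φ = shear j (-t) (PointBlowup.killVar j Φ) := by
  conv_lhs => rw [← shear_neg_shear j ht Φ]
  rw [← killVar_shear j t Φ,
    killVar_eq_self_of_free (shear_free_of_direction_mem_additiveSubspace p hΦ hdp j ht hmem)]

/-- The same with an arbitrary kernel vector normalised by `u_j = 1`. [OURS]
[cite: CossartJannsenSaito2020, Def. 2.8, Thm. 3.14] -/
theorem eq_shear_killVar_of_mem_additiveSubspace (p : ℕ) [Fact p.Prime] [CharP K p]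
    {Φ : MvPolynomial (Fin 4) K} {d : ℕ} (hΦ : Φ.IsHomogeneous d) (hdp : d < p) (j : Fin 4)
    {u : Fin 4 → K} (hu : u ∈ additiveSubspace Φ) (huj : u j = 1) :
    Φ = shear j (-Function.update u j 0) (PointBlowup.killVar j Φ) :=
  eq_shear_killVar_of_direction_mem_additiveSubspace p hΦ hdp j (Function.update_self ..)
    (by rwa [direction_update_zero_of_apply_eq_one huj])

/-! ## 3. Form persistence at a shade-keeping band step -/

section Step

variable [DecidableEq K]

/-- The new residual cone of a shade-keeping band step is homogeneous of the OLD residual degree `o − |r|`.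
[folklore] -/
theorem resForm_step_isHomogeneous {q : ℕ} (j : Fin 4) {b : Fin 4 → K} (hbj : b j = 0) {s : State K}
    {o : ℕ} (ho : ordZero s.F = o) (hr : ∀ d ∈ s.F.support, s.r ≤ d)
    (heq : (CentreBlowup.step q Finset.univ j b s).shade = s.shade) :
    (resForm (CentreBlowup.step q Finset.univ j b s)).IsHomogeneous (o - s.r.degree) := by
  have ho' := ordZero_step_of_shade_eq j hbj ho hr heq
  have h := resForm_isHomogeneous ho'
  rwa [Nat.add_sub_cancel_left] at h

/-- **FORM PERSISTENCE** (idea-4 (B-PERSIST), every `e_G ≥ 1`, every prime): at a shade-keeping band step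
`s →(j, b) s′` with TAME residual degree `o − |r| < p`, for every `u ∈ resVertex s′` with `u_j = 1` the new residual
cone is the old one up to a unit and a unipotent substitution:
`resForm s′ = c • shear j (b − u♭) (resForm s)`, `u♭ = update u j 0`, `c = coeff_top (shear j b x^r) ≠ 0`.
[OURS] [cite: CossartJannsenSaito2020, Thm. 3.10(4), Thm. 3.14, Thm. 9.3] -/
theorem resForm_step_eq_smul_shear (p : ℕ) [Fact p.Prime] [CharP K p] {q : ℕ} (j : Fin 4) {b : Fin 4 → K}
    (hbj : b j = 0) {s : State K} {o : ℕ} (ho : ordZero s.F = o) (hr : ∀ d ∈ s.F.support, s.r ≤ d)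
    (hqo : q < o) (ho2 : o < 2 * q) (heq : (CentreBlowup.step q Finset.univ j b s).shade = s.shade)
    (hd : o - s.r.degree < p) {u : Fin 4 → K} (hu : u ∈ resVertex (CentreBlowup.step q Finset.univ j b s))
    (huj : u j = 1) :
    resForm (CentreBlowup.step q Finset.univ j b s) =
      coeff (topMonomial j b s.r) (shear j b (monomial s.r (1 : K))) •
        shear j (b - Function.update u j 0) (resForm s) := by
  have h := eq_shear_killVar_of_mem_additiveSubspace p (resForm_step_isHomogeneous j hbj ho hr heq) hd j hu huj
  rw [h, killVar_resForm_step j hbj ho hr hqo ho2 heq, shear_smul, shear_shear j _ b hbj, sub_eq_add_neg]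

/-- On a constant-`e_G` shade-keeping band step the new polar kernel has a vector with `u_j = 1`
(`…ResConeSatLocated.not_resVertex_step_le_hyperplane_of_finrank_eq`). [OURS]
[cite: CossartJannsenSaito2020, Thm. 3.10(4)] -/
theorem exists_transversal_of_finrank_eq {q : ℕ} (j : Fin 4) {b : Fin 4 → K} (hbj : b j = 0) {s : State K}
    {o : ℕ} (ho : ordZero s.F = o) (hr : ∀ d ∈ s.F.support, s.r ≤ d) (hqo : q < o) (ho2 : o < 2 * q)
    (heq : (CentreBlowup.step q Finset.univ j b s).shade = s.shade)
    (he : Module.finrank K (resVertex (CentreBlowup.step q Finset.univ j b s)) =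
      Module.finrank K (resVertex s)) :
    ∃ u ∈ resVertex (CentreBlowup.step q Finset.univ j b s), u j = 1 := by
  have h := not_resVertex_step_le_hyperplane_of_finrank_eq j hbj ho hr hqo ho2 heq he
  obtain ⟨w, hw, hwj⟩ := Set.not_subset.mp h
  have hwj' : w j ≠ 0 := fun h0 => hwj (mem_hyperplane.mpr h0)
  refine ⟨(w j)⁻¹ • w, Submodule.smul_mem _ _ hw, ?_⟩
  rw [Pi.smul_apply, smul_eq_mul, inv_mul_cancel₀ hwj']

/-- **FORM PERSISTENCE ON A CONSTANT-`e_G` STEP**: at a shade-keeping band step with tame residual degree and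
`e_G(s′) = e_G(s)` there is `t` (`t_j = 0`, `e_j + t ∈ resVertex s′`) with
`resForm s′ = c • shear j (b − t) (resForm s)` and `c ≠ 0` — at `e_G = 2` the binary-form class of the cone is
KEPT (idea-4 (B-PERSIST) / I-4-8 §A). [OURS] [cite: CossartJannsenSaito2020, Thm. 3.10(4), Thm. 3.14, Thm. 9.3] -/
theorem exists_resForm_step_eq_smul_shear_of_finrank_eq (p : ℕ) [Fact p.Prime] [CharP K p] {q : ℕ}
    (j : Fin 4) {b : Fin 4 → K} (hbj : b j = 0) {s : State K} {o : ℕ} (ho : ordZero s.F = o)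
    (hr : ∀ d ∈ s.F.support, s.r ≤ d) (hqo : q < o) (ho2 : o < 2 * q)
    (heq : (CentreBlowup.step q Finset.univ j b s).shade = s.shade) (hd : o - s.r.degree < p)
    (he : Module.finrank K (resVertex (CentreBlowup.step q Finset.univ j b s)) =
      Module.finrank K (resVertex s)) :
    ∃ t : Fin 4 → K, t j = 0 ∧ direction j t ∈ resVertex (CentreBlowup.step q Finset.univ j b s) ∧
      coeff (topMonomial j b s.r) (shear j b (monomial s.r (1 : K))) ≠ 0 ∧
      resForm (CentreBlowup.step q Finset.univ j b s) =
        coeff (topMonomial j b s.r) (shear j b (monomial s.r (1 : K))) • shear j (b - t) (resForm s) := by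
  obtain ⟨u, hu, huj⟩ := exists_transversal_of_finrank_eq j hbj ho hr hqo ho2 heq he
  refine ⟨Function.update u j 0, Function.update_self .., ?_, coeff_topMonomial_ne_zero j hbj s.r,
    resForm_step_eq_smul_shear p j hbj ho hr hqo ho2 heq hd hu huj⟩
  rwa [direction_update_zero_of_apply_eq_one huj]

/-! ## 4. The substitution read off the NEXT step -/

/-- **Persistence read off a FREE successor**: if the next step `s′ →(j′, b′) s″` is again a shade-keeping band
step and its direction `e_{j′} + b′` (which lies in `resVertex s′`, (VT)(i)) has a non-zero `j`-coordinate — the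
successor LEAVES `E_j` — then that direction, normalised, is the `u` of `resForm_step_eq_smul_shear`. [OURS]
[cite: CossartJannsenSaito2020, Thm. 3.14] -/
theorem resForm_step_eq_smul_shear_of_next (p : ℕ) [Fact p.Prime] [CharP K p] {q : ℕ} {j j' : Fin 4}
    {b b' : Fin 4 → K} (hbj : b j = 0) (hb'j' : b' j' = 0) {s : State K} {o o' : ℕ} (ho : ordZero s.F = o)
    (hr : ∀ d ∈ s.F.support, s.r ≤ d) (hqo : q < o) (ho2 : o < 2 * q)
    (heq : (CentreBlowup.step q Finset.univ j b s).shade = s.shade) (hd : o - s.r.degree < p)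
    (ho' : ordZero (CentreBlowup.step q Finset.univ j b s).F = o')
    (hr' : ∀ d ∈ (CentreBlowup.step q Finset.univ j b s).F.support, (CentreBlowup.step q Finset.univ j b s).r ≤ d)
    (hqo' : q < o') (ho'2 : o' < 2 * q)
    (heq' : (CentreBlowup.step q Finset.univ j' b' (CentreBlowup.step q Finset.univ j b s)).shade =
      (CentreBlowup.step q Finset.univ j b s).shade)
    (hfree : direction j' b' j ≠ 0) :
    resForm (CentreBlowup.step q Finset.univ j b s) =
      coeff (topMonomial j b s.r) (shear j b (monomial s.r (1 : K))) •
        shear j (b - Function.update ((direction j' b' j)⁻¹ • direction j' b') j 0) (resForm s) := by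
  have hv := direction_mem_resVertex_of_shade_eq j' hb'j' ho' hr' hqo' ho'2 heq'
  refine resForm_step_eq_smul_shear p j hbj ho hr hqo ho2 heq hd (Submodule.smul_mem _ _ hv) ?_
  rw [Pi.smul_apply, smul_eq_mul, inv_mul_cancel₀ hfree]

/-- **Persistence read off a REPEAT** (`j′ = j`, the most frequent move of a free run): the next direction is
`e_j + b′` itself, so `resForm s′ = c • shear j (b − b′) (resForm s)`. [OURS] [cite: CossartJannsenSaito2020, Thm. 3.14] -/
theorem resForm_step_eq_smul_shear_of_repeat (p : ℕ) [Fact p.Prime] [CharP K p] {q : ℕ} {j : Fin 4}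
    {b b' : Fin 4 → K} (hbj : b j = 0) (hb'j : b' j = 0) {s : State K} {o o' : ℕ} (ho : ordZero s.F = o)
    (hr : ∀ d ∈ s.F.support, s.r ≤ d) (hqo : q < o) (ho2 : o < 2 * q)
    (heq : (CentreBlowup.step q Finset.univ j b s).shade = s.shade) (hd : o - s.r.degree < p)
    (ho' : ordZero (CentreBlowup.step q Finset.univ j b s).F = o')
    (hr' : ∀ d ∈ (CentreBlowup.step q Finset.univ j b s).F.support, (CentreBlowup.step q Finset.univ j b s).r ≤ d)
    (hqo' : q < o') (ho'2 : o' < 2 * q)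
    (heq' : (CentreBlowup.step q Finset.univ j b' (CentreBlowup.step q Finset.univ j b s)).shade =
      (CentreBlowup.step q Finset.univ j b s).shade) :
    resForm (CentreBlowup.step q Finset.univ j b s) =
      coeff (topMonomial j b s.r) (shear j b (monomial s.r (1 : K))) • shear j (b - b') (resForm s) := by
  have hv := direction_mem_resVertex_of_shade_eq j hb'j ho' hr' hqo' ho'2 heq'
  have h := resForm_step_eq_smul_shear p j hbj ho hr hqo ho2 heq hd hv (direction_apply_self j b')
  have hb' : Function.update (direction j b') j 0 = b' := by
    unfold direction
    rw [Function.update_idem, ← hb'j, Function.update_eq_self]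
  rwa [hb'] at h

end Step

end ResCone

end Summit.ResolutionOfSingularities.ResolutionOfSingularities.Theorems.PIDim4

end
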